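import Mathlib
import HarnessLib
import Summits.NavierStokesRegularity.NavierStokesRegularity.Theorems.TypeILiouvilleStrainLedgerStarved

/-!
# TypeILiouvilleStrainLedgerAligned — crux (L) stmt-NavierStokesRegularity-10661 `TypeIliouvilleL`, registered stub
# `stub_quiescentLiouville` (L_Q): THE ALIGNED LEDGER — only stretching ALONG THE VORTICITY DIRECTION is charged

Helper for stmt-NavierStokesRegularity-10661 (`--supports`); theorems only, no definitions, no named-fact hypotheses;
closes no item; Navier–Stokes regularity is NOT proved here (leafhand seat of the EulerZoomLiouville route).
Sharpening of `TypeILiouvilleStrainLedgerExtinction` / `…Starved`: the weak-maximum-principle proof of VE reads the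
stretching term only at `ξ = ω(τ,x)`, so the strain majorant `⟪∇v ξ,ξ⟫ ≤ Λ‖ξ‖²` (all `ξ`; `λ_max(S) ≤ Λ`) may be
replaced by the ALIGNED STRETCHING RATE `σ(τ,x) = ⟪S(τ,x) ξ_ω, ξ_ω⟫`, `ξ_ω = ω/|ω|` (Constantin's depletion
quantity): vorticity sitting in compressive or neutral eigen-directions of the strain is not charged.

* `norm_curl_le_mul_exp_integral_alignedStretching` — **ALIGNED VE**: `⟪∇v(τ,x) ω, ω⟫ ≤ Λ(τ)|ω|²` on `[s,t]` and
  `‖ω(s,·)‖ ≤ Ω₀` give `‖ω(t,x)‖ ≤ Ω₀ · exp ∫_s^t Λ`.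
* `const_of_alignedStarved` — aligned-starved class-P flows are constant.
* `const_of_alignedStretching_lt_vorticity_decay` — **THE TYPE-I DOOR'S TWO DIALS, ALIGNED**: aligned stretching rate
  `≤ a/(−τ)` and vorticity decay `‖ω‖ ≤ M(−τ)^{−β}` with `a < β` ⟹ constant.  Contrapositive on L_Q: a counterexample
  whose vorticity decays at exponent `β` must carry ALIGNED stretching number `≥ β` somewhere on every far past.
[cite: MajdaBertozzi2002, eq. (3.80); Constantin1994, §2 (geometric depletion); KochNadirashviliSereginSverak2009, §4]
-/

noncomputable section
open MeasureTheory Filter Set Function Metric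
open scoped Topology RealInnerProductSpace ContDiff Laplacian ENNReal NNReal
open Literature.Analysis Literature.Analysis.FluidPDE Literature.Analysis.UnboundedOperators
set_option linter.dupNamespace false
namespace Summit.NavierStokesRegularity.NavierStokesRegularity.Theorems.TypeILiouvilleStrainLedger

/-- **ALIGNED VE.**  For a class-P flow, a window `[s,t] ⊂ (−∞,0)`, a continuous `Λ` majorising the stretching rate
ALONG THE VORTICITY only — `⟪∇v(τ,x) ω(τ,x), ω(τ,x)⟫ ≤ Λ τ · ‖ω(τ,x)‖²` for `τ ∈ [s,t]` — and a bound
`‖ω(s,·)‖ ≤ Ω₀`: `‖ω(t,x)‖ ≤ Ω₀ · exp ∫_s^t Λ`.  Same weak-maximum-principle proof as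
`norm_curl_le_mul_exp_integral_strain` (the gauged enstrophy `e^{−2∫Λ}|ω|²` is a bounded subsolution), which reads
the strain only at `ξ = ω`. [cite: MajdaBertozzi2002, eq. (3.80); Constantin1994, §2] -/
theorem norm_curl_le_mul_exp_integral_alignedStretching
    {v : ℝ → EuclideanSpace ℝ (Fin 3) → EuclideanSpace ℝ (Fin 3)}
    (hc : ContinuousOn (uncurry v) (Iio 0 ×ˢ univ))
    (hK : ∃ K : ℝ, ∀ t < 0, ∀ x, ‖v t x‖ ≤ K)
    (hd : ∀ t < 0, IsWeaklyDivFree (v t))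
    (hm : ∀ s t : ℝ, s < t → t < 0 → ∀ x,
      v t x = heatExtension (v s) (t - s) x - oseenDuhamel 1 s v v t x)
    {s t : ℝ} (hst : s < t) (ht : t < 0) {Λ : ℝ → ℝ} (hΛc : Continuous Λ)
    (hΛ : ∀ τ ∈ Icc s t, ∀ x : EuclideanSpace ℝ (Fin 3),
      ⟪fderiv ℝ (v τ) x (curl (v τ) x), curl (v τ) x⟫ ≤ Λ τ * ‖curl (v τ) x‖ ^ 2)
    {Ω₀ : ℝ} (hΩ : ∀ x, ‖curl (v s) x‖ ≤ Ω₀) (x : EuclideanSpace ℝ (Fin 3)) :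
    ‖curl (v t) x‖ ≤ Ω₀ * Real.exp (∫ τ in s..t, Λ τ) := by
  obtain ⟨K, hKb⟩ := hK
  have hK0 : 0 ≤ K := (norm_nonneg _).trans (hKb (-1) (by norm_num) 0)
  have hΩ0 : 0 ≤ Ω₀ := (norm_nonneg _).trans (hΩ x)
  obtain ⟨hsm', hbounds⟩ := smooth_and_bounds_of_bounded_ancient_oseenMild hc hd hm hKb
  have hsm : IsSmoothSpaceTimeOn (Iio 0) v := hsm'
  have hvort : IsSmoothSpaceTimeOn (Iio 0) (vorticity v) := isSmoothSpaceTimeOn_vorticity_Iio hsm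
  -- uniform vorticity bound `‖ω‖ ≤ ‖curlCLM‖ C₁`
  obtain ⟨C₁, hC₁⟩ := hbounds 1
  have hωbd : ∀ τ < 0, ∀ y, ‖curl (v τ) y‖ ≤ ‖curlCLM‖ * C₁ := by
    intro τ hτ y
    have h1 : ‖fderiv ℝ (v τ) y‖ ≤ C₁ := by
      have := hC₁ τ hτ y; rwa [norm_iteratedFDeriv_one] at this
    calc ‖curl (v τ) y‖ = ‖curlCLM (fderiv ℝ (v τ) y)‖ := rfl
      _ ≤ ‖curlCLM‖ * ‖fderiv ℝ (v τ) y‖ := ContinuousLinearMap.le_opNorm _ _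
      _ ≤ ‖curlCLM‖ * C₁ := mul_le_mul_of_nonneg_left h1 (norm_nonneg curlCLM)
  -- the temporal gauge `G τ = ∫_s^τ Λ`, `G' = Λ`, `G s = 0`
  set G : ℝ → ℝ := fun τ => ∫ r in s..τ, Λ r with hG_def
  have hG : ∀ τ, HasDerivAt G (Λ τ) τ := fun τ =>
    intervalIntegral.integral_hasDerivAt_right (hΛc.intervalIntegrable _ _)
      (hΛc.stronglyMeasurableAtFilter _ _) hΛc.continuousAt
  have hGc : Continuous G := continuous_iff_continuousAt.2 fun τ => (hG τ).continuousAt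
  have hGs : G s = 0 := by simp [hG_def]
  -- the gauged enstrophy density and its time derivative
  set P : ℝ → EuclideanSpace ℝ (Fin 3) → ℝ :=
    fun τ y => Real.exp (-2 * G τ) * ‖curl (v τ) y‖ ^ 2 with hP_def
  set Pt : ℝ → EuclideanSpace ℝ (Fin 3) → ℝ := fun τ y =>
    Real.exp (-2 * G τ) * (-2 * Λ τ) * ‖curl (v τ) y‖ ^ 2 +
      Real.exp (-2 * G τ) * (2 * ⟪curl (v τ) y, deriv (fun r => curl (v r) y) τ⟫) with hPt_def
  have hE : ∀ τ, HasDerivAt (fun r => Real.exp (-2 * G r)) (Real.exp (-2 * G τ) * (-2 * Λ τ)) τ :=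
    fun τ => ((hG τ).const_mul (-2)).exp
  have hIcc : Icc s t ⊆ Iio 0 := fun τ hτ => lt_of_le_of_lt hτ.2 ht
  -- a bound for `G` on the window
  obtain ⟨M, hM⟩ := isCompact_Icc.exists_bound_of_continuousOn (hGc.continuousOn (s := Icc s t))
  -- the weak maximum principle
  have hmp := le_of_subsolution_linear_drift (T₁ := s) (T₂ := t) (M := Ω₀ ^ 2)
    (B := Real.exp (2 * M) * (‖curlCLM‖ * C₁) ^ 2) hK0 (P := P) (Pₜ := Pt) ?hc ?h2 ?ht ?hsub ?hB ?hM
  case hc =>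
    have h1 : ContinuousOn (fun p : ℝ × EuclideanSpace ℝ (Fin 3) => ‖uncurry (vorticity v) p‖ ^ 2)
        (Icc s t ×ˢ univ) :=
      ((hvort.continuousOn.mono (prod_mono hIcc Subset.rfl)).norm).pow 2
    have h2 : ContinuousOn (fun p : ℝ × EuclideanSpace ℝ (Fin 3) => Real.exp (-2 * G p.1))
        (Icc s t ×ˢ univ) :=
      ((Real.continuous_exp.comp ((continuous_const.mul hGc).comp continuous_fst))).continuousOn
    exact (h2.mul h1).congr fun p _ => rfl
  case h2 =>
    intro τ hτ
    have hOm : ContDiff ℝ 2 (curl (v τ)) :=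
      (hvort.contDiff_slice (hIcc ⟨hτ.1.le, hτ.2⟩)).of_le (by norm_cast)
    exact contDiff_const.mul ((contDiff_norm_sq ℝ).comp hOm)
  case ht =>
    intro τ hτ y
    have hτ0 : τ ∈ Iio (0 : ℝ) := hIcc ⟨hτ.1.le, hτ.2⟩
    have hOmt : HasDerivAt (fun r => curl (v r) y) (deriv (fun r => curl (v r) y) τ) τ :=
      hvort.hasDerivAt_timeLine isOpen_Iio hτ0 y
    have hqt : HasDerivAt (fun r => ‖curl (v r) y‖ ^ 2)
        (2 * ⟪curl (v τ) y, deriv (fun r => curl (v r) y) τ⟫) τ := hOmt.norm_sq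
    exact (hE τ).mul hqt
  case hB =>
    intro τ hτ y
    have hτ0 : τ < 0 := hIcc hτ
    have hGτ : -2 * G τ ≤ 2 * M := by
      have := hM τ hτ; rw [Real.norm_eq_abs] at this
      have := neg_abs_le (G τ); linarith
    have h1 : Real.exp (-2 * G τ) ≤ Real.exp (2 * M) := Real.exp_le_exp.2 hGτ
    have h2 : ‖curl (v τ) y‖ ^ 2 ≤ (‖curlCLM‖ * C₁) ^ 2 :=
      pow_le_pow_left₀ (norm_nonneg _) (hωbd τ hτ0 y) 2
    exact mul_le_mul h1 h2 (sq_nonneg _) (Real.exp_pos _).le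
  case hM =>
    intro y
    have h2 : ‖curl (v s) y‖ ^ 2 ≤ Ω₀ ^ 2 := pow_le_pow_left₀ (norm_nonneg _) (hΩ y) 2
    simp only [hP_def, hGs, mul_zero, Real.exp_zero, one_mul]
    exact h2
  case hsub =>
    intro τ hτ y
    have hτ0 : τ < 0 := hIcc ⟨hτ.1.le, hτ.2⟩
    have hτ0' : τ ∈ Iio (0 : ℝ) := hτ0
    -- abbreviations
    set c : ℝ := Real.exp (-2 * G τ) with hc_def
    have hc0 : 0 < c := Real.exp_pos _
    have hOm : ContDiff ℝ 2 (curl (v τ)) := (hvort.contDiff_slice hτ0').of_le (by norm_cast)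
    have hOmd : DifferentiableAt ℝ (curl (v τ)) y := (hOm.differentiable two_ne_zero) y
    have hq2 : ContDiff ℝ 2 (fun z => ‖curl (v τ) z‖ ^ 2) := (contDiff_norm_sq ℝ).comp hOm
    have hqd : DifferentiableAt ℝ (fun z => ‖curl (v τ) z‖ ^ 2) y := (hq2.differentiable two_ne_zero) y
    -- spatial derivatives of the slice `P τ = c • |ω|²`
    have hPslice : P τ = fun z => c * ‖curl (v τ) z‖ ^ 2 := rfl
    have hfd : ∀ w, fderiv ℝ (P τ) y w = c * (2 * ⟪curl (v τ) y, fderiv ℝ (curl (v τ)) y w⟫) := by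
      intro w
      rw [hPslice, fderiv_const_mul hqd, FunLike.coe_smul, Pi.smul_apply, smul_eq_mul,
        fderiv_norm_sq_comp_apply hOmd w]
    have hΔ : (Δ (P τ)) y =
        c * (2 * ⟪(Δ (curl (v τ))) y, curl (v τ) y⟫ + 2 * frobeniusNormSq (fderiv ℝ (curl (v τ)) y)) := by
      have h1 : (Δ (c • fun z => ‖curl (v τ) z‖ ^ 2)) y = c • (Δ fun z => ‖curl (v τ) z‖ ^ 2) y :=
        InnerProductSpace.laplacian_smul c hq2.contDiffAt
      have h2 : (c • fun z => ‖curl (v τ) z‖ ^ 2) = P τ := by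
        funext z; simp [hPslice, smul_eq_mul]
      rw [← h2, h1, smul_eq_mul, laplacian_norm_sq_comp hOm y]
    -- the vorticity equation at `(τ, y)`
    have hveq := classP_vorticity_eq hc ⟨K, hKb⟩ hd hm hτ0 y
    -- the stretching term is majorised: `⟪Dv ω, ω⟫ ≤ Λ ‖ω‖²`
    have hstr : ⟪fderiv ℝ (v τ) y (curl (v τ) y), curl (v τ) y⟫ ≤ Λ τ * ‖curl (v τ) y‖ ^ 2 :=
      hΛ τ ⟨hτ.1.le, hτ.2⟩ y
    -- the transport term is a drift: `|DP(y) u| ≤ K ‖DP(y)‖`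
    have hdrift : -(fderiv ℝ (P τ) y (v τ y)) ≤ K * (1 + ‖y‖) * ‖fderiv ℝ (P τ) y‖ := by
      have h1 : |fderiv ℝ (P τ) y (v τ y)| ≤ ‖fderiv ℝ (P τ) y‖ * ‖v τ y‖ := by
        rw [← Real.norm_eq_abs]; exact ContinuousLinearMap.le_opNorm _ _
      have h2 : ‖fderiv ℝ (P τ) y‖ * ‖v τ y‖ ≤ ‖fderiv ℝ (P τ) y‖ * K :=
        mul_le_mul_of_nonneg_left (hKb τ hτ0 y) (norm_nonneg _)
      have h3 : ‖fderiv ℝ (P τ) y‖ * K ≤ K * (1 + ‖y‖) * ‖fderiv ℝ (P τ) y‖ := by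
        nlinarith [mul_nonneg (mul_nonneg hK0 (norm_nonneg y)) (norm_nonneg (fderiv ℝ (P τ) y))]
      linarith [neg_abs_le (fderiv ℝ (P τ) y (v τ y))]
    -- assemble: `Pt = -2cΛ|ω|² + 2c⟪ω, ω'⟫`, `ω' = Dv ω + Δω - Dω u`
    have hωt : deriv (fun r => curl (v r) y) τ =
        fderiv ℝ (v τ) y (curl (v τ) y) + (Δ (curl (v τ))) y - fderiv ℝ (curl (v τ)) y (v τ y) := by
      rw [← hveq]; abel
    have hPt : Pt τ y = c * (-2 * Λ τ) * ‖curl (v τ) y‖ ^ 2 +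
        c * (2 * ⟪curl (v τ) y, deriv (fun r => curl (v r) y) τ⟫) := rfl
    rw [hPt, hωt, inner_sub_right, inner_add_right, hΔ]
    have hfdv := hfd (v τ y)
    rw [hfdv] at hdrift
    have hF := frobeniusNormSq_nonneg (fderiv ℝ (curl (v τ)) y)
    have hcomm1 : ⟪curl (v τ) y, fderiv ℝ (v τ) y (curl (v τ) y)⟫ =
        ⟪fderiv ℝ (v τ) y (curl (v τ) y), curl (v τ) y⟫ := real_inner_comm _ _
    have hcomm2 : ⟪curl (v τ) y, (Δ (curl (v τ))) y⟫ = ⟪(Δ (curl (v τ))) y, curl (v τ) y⟫ :=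
      real_inner_comm _ _
    rw [hcomm1, hcomm2]
    nlinarith [mul_nonneg hc0.le hF, mul_le_mul_of_nonneg_left hstr hc0.le]
  -- conclusion at `(t, x)`
  have hPt_le : P t x ≤ Ω₀ ^ 2 := hmp t ⟨hst.le, le_rfl⟩ x
  have hsq : ‖curl (v t) x‖ ^ 2 ≤ (Ω₀ * Real.exp (G t)) ^ 2 := by
    have h1 : Real.exp (-2 * G t) * ‖curl (v t) x‖ ^ 2 ≤ Ω₀ ^ 2 := hPt_le
    have h2 : Real.exp (-2 * G t) * Real.exp (G t) ^ 2 = 1 := by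
      rw [← Real.exp_nat_mul, ← Real.exp_add]; norm_num
    nlinarith [Real.exp_pos (G t), sq_nonneg (Real.exp (G t))]
  have hfin : ‖curl (v t) x‖ ≤ Ω₀ * Real.exp (G t) :=
    (pow_le_pow_iff_left₀ (norm_nonneg _) (mul_nonneg hΩ0 (Real.exp_pos _).le) two_ne_zero).1 hsq
  simpa [hG_def] using hfin


/-- **ALIGNED-STARVED ⟹ CONSTANT.**  If at every `t < 0`, for every `ε > 0`, some window `[s,t]` carries a continuous
aligned-stretching majorant `Λ` and a vorticity bound `Ω₀` at `s` with `Ω₀ · exp ∫_s^t Λ < ε`, the class-P flow is one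
constant vector (aligned VE kills the vorticity; `const_of_curl_eq_zero`). [cite: MajdaBertozzi2002, eq. (3.80)] -/
theorem const_of_alignedStarved
    {v : ℝ → EuclideanSpace ℝ (Fin 3) → EuclideanSpace ℝ (Fin 3)}
    (hc : ContinuousOn (uncurry v) (Iio 0 ×ˢ univ))
    (hK : ∃ K : ℝ, ∀ t < 0, ∀ x, ‖v t x‖ ≤ K)
    (hd : ∀ t < 0, IsWeaklyDivFree (v t))
    (hm : ∀ s t : ℝ, s < t → t < 0 → ∀ x,
      v t x = heatExtension (v s) (t - s) x - oseenDuhamel 1 s v v t x)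
    (hstarved : ∀ t < 0, ∀ ε : ℝ, 0 < ε → ∃ s : ℝ, s < t ∧ ∃ Λ : ℝ → ℝ, Continuous Λ ∧
      (∀ τ ∈ Icc s t, ∀ x : EuclideanSpace ℝ (Fin 3),
        ⟪fderiv ℝ (v τ) x (curl (v τ) x), curl (v τ) x⟫ ≤ Λ τ * ‖curl (v τ) x‖ ^ 2) ∧
      ∃ Ω₀ : ℝ, (∀ x, ‖curl (v s) x‖ ≤ Ω₀) ∧ Ω₀ * Real.exp (∫ τ in s..t, Λ τ) < ε) :
    ∃ b : EuclideanSpace ℝ (Fin 3), ∀ t < 0, ∀ x, v t x = b := by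
  refine const_of_curl_eq_zero hc hK hd hm fun t ht x => ?_
  by_contra hne
  have hpos : 0 < ‖curl (v t) x‖ := norm_pos_iff.2 hne
  obtain ⟨s, hst, Λ, hΛc, hΛ, Ω₀, hΩ, hlt⟩ := hstarved t ht _ hpos
  have hle := norm_curl_le_mul_exp_integral_alignedStretching hc hK hd hm hst ht hΛc hΛ hΩ x
  linarith

/-- **THE TYPE-I DOOR'S TWO DIALS, ALIGNED.**  A class-P flow whose ALIGNED stretching rate is harmonically bounded,
`⟪∇v(τ,x) ω, ω⟫ ≤ (a/(−τ))‖ω‖²`, and whose vorticity decays like `‖ω(τ,x)‖ ≤ M(−τ)^{−β}` with `a < β`, is one constant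
vector (ledger of `[−σ,t]` = `M(−t)^{−a} σ^{a−β} → 0`).  Sharpens `const_of_stretching_lt_vorticity_decay` (all
directions) to the vorticity direction. [cite: MajdaBertozzi2002, eq. (3.80); Constantin1994, §2] -/
theorem const_of_alignedStretching_lt_vorticity_decay
    {v : ℝ → EuclideanSpace ℝ (Fin 3) → EuclideanSpace ℝ (Fin 3)}
    (hc : ContinuousOn (uncurry v) (Iio 0 ×ˢ univ))
    (hK : ∃ K : ℝ, ∀ t < 0, ∀ x, ‖v t x‖ ≤ K)
    (hd : ∀ t < 0, IsWeaklyDivFree (v t))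
    (hm : ∀ s t : ℝ, s < t → t < 0 → ∀ x,
      v t x = heatExtension (v s) (t - s) x - oseenDuhamel 1 s v v t x)
    {a β M : ℝ} (haβ : a < β)
    (hstr : ∀ τ < 0, ∀ x : EuclideanSpace ℝ (Fin 3),
      ⟪fderiv ℝ (v τ) x (curl (v τ) x), curl (v τ) x⟫ ≤ a / (-τ) * ‖curl (v τ) x‖ ^ 2)
    (hω : ∀ τ < 0, ∀ x : EuclideanSpace ℝ (Fin 3), ‖curl (v τ) x‖ ≤ M * (-τ) ^ (-β)) :
    ∃ b : EuclideanSpace ℝ (Fin 3), ∀ t < 0, ∀ x, v t x = b := by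
  refine const_of_alignedStarved hc hK hd hm fun t ht ε hε => ?_
  have ht0 : 0 < -t := neg_pos.2 ht
  -- the majorant, continuous on `ℝ`, equal to `a/(−τ)` for `τ ≤ t`
  set Λ : ℝ → ℝ := fun τ => a / max (-τ) (-t) with hΛ
  have hden : ∀ τ : ℝ, max (-τ) (-t) ≠ 0 := fun τ => (lt_of_lt_of_le ht0 (le_max_right _ _)).ne'
  have hΛc : Continuous Λ := continuous_const.div (continuous_neg.max continuous_const) hden
  have hΛeq : ∀ τ, τ ≤ t → Λ τ = a / (-τ) := fun τ hτ => by
    simp only [hΛ, max_eq_left (neg_le_neg hτ)]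
  -- the ledger tends to zero along `s = −σ → −∞`
  have hlim : Tendsto (fun σ : ℝ => M * (-t) ^ (-a) * σ ^ (a - β)) atTop (𝓝 0) := by
    have h := (tendsto_rpow_neg_atTop (y := β - a) (by linarith)).const_mul (M * (-t) ^ (-a))
    rw [mul_zero] at h
    exact h.congr' (Eventually.of_forall fun σ => by rw [neg_sub])
  obtain ⟨σ₀, hσ₀⟩ := (hlim.eventually (gt_mem_nhds hε)).exists_forall_of_atTop
  set σ : ℝ := max σ₀ (-t + 1) with hσ
  have hσt : -t < σ := by rw [hσ]; linarith [le_max_right σ₀ (-t + 1)]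
  have hσ0 : 0 < σ := ht0.trans hσt
  have hst : -σ < t := by linarith
  have hs0 : -σ < 0 := by linarith
  refine ⟨-σ, hst, Λ, hΛc, fun τ hτ x => ?_, M * σ ^ (-β), fun x => ?_, ?_⟩
  · rw [hΛeq τ hτ.2]
    exact hstr τ (lt_of_le_of_lt hτ.2 ht) x
  · have h := hω (-σ) hs0 x
    rwa [neg_neg] at h
  · -- `∫_{−σ}^t Λ = a (log σ − log (−t))`
    have hderiv : ∀ τ ∈ uIcc (-σ) t, HasDerivAt (fun r => -a * Real.log (-r)) (Λ τ) τ := by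
      intro τ hτ
      rw [uIcc_of_le hst.le] at hτ
      have hτ0 : -τ ≠ 0 := (neg_pos.2 (lt_of_le_of_lt hτ.2 ht)).ne'
      have h1 : HasDerivAt (fun r : ℝ => Real.log (-r)) ((-τ)⁻¹ * (-1)) τ :=
        (Real.hasDerivAt_log hτ0).comp τ (hasDerivAt_neg τ)
      have h2 := h1.const_mul (-a)
      rw [hΛeq τ hτ.2]
      refine h2.congr_deriv ?_
      rw [div_eq_mul_inv]; ring
    have hint : ∫ τ in (-σ)..t, Λ τ = a * (Real.log σ - Real.log (-t)) := by
      rw [intervalIntegral.integral_eq_sub_of_hasDerivAt hderiv (hΛc.intervalIntegrable _ _)]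
      simp only [neg_neg]
      ring
    rw [hint]
    have hexp : Real.exp (a * (Real.log σ - Real.log (-t))) = σ ^ a * (-t) ^ (-a) := by
      rw [Real.rpow_def_of_pos hσ0, Real.rpow_def_of_pos ht0, ← Real.exp_add]
      congr 1; ring
    rw [hexp]
    have hcalc : M * σ ^ (-β) * (σ ^ a * (-t) ^ (-a)) = M * (-t) ^ (-a) * σ ^ (a - β) := by
      rw [sub_eq_add_neg, Real.rpow_add hσ0, ← mul_assoc]
      ring
    rw [hcalc]
    exact hσ₀ σ (le_max_left _ _)


end Summit.NavierStokesRegularity.NavierStokesRegularity.Theorems.TypeILiouvilleStrainLedger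

end
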